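import Literature.NumberTheory.EllipticCurves.PAdicLFunctionDistributionHoldsProofs
import Literature.NumberTheory.EllipticCurves.PAdicLFunctionInterpolationProofs
import Literature.NumberTheory.EllipticCurves.PAdicLFunctionProofs
import HarnessLib

/-!
# Stub `stub_heckeDescent` (line `Sketch` = `kurihara-fourier-support`, crux `PlecticLegs.TwistSupply`)

**Hecke descent of twisted plus-symbol sums** (Fearnley–Kisilevsky–Kuwata 2012, proof of
Thm. 3.5; Mazur–Tate–Teitelbaum 1986, §I.4 (4.2)). Let `f ∈ S₂(Γ₀(N))` be a normalised newform
with rational coefficients, `[r]⁺ = ratPlusSymbol f r ∈ ℚ` its rational plus symbol, `n` a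
square-free integer prime to `N`, `d ∣ n` and `χ'` a Dirichlet character mod `d`. For
`d ∣ M` write `T_M = ∑_{c mod M, (c, M) = 1} χ'(c) [c/M]⁺`. For a prime `q ∤ M N` the Hecke
relation `a_q [r]⁺ = ∑_{j mod q} [(r + j)/q]⁺ + [q r]⁺` (tree: `cuspCoeff_mul_plusSymbol`,
made rational by `ratCast_ratPlusSymbol_holds` and real by
`cuspCoeff_im_eq_zero_of_coeffField_eq_bot`), summed against `χ'` over the units mod `M`, gives

  `T_{Mq} = (a_q − χ'(q) − χ'(q)⁻¹) · T_M`

(`heckeDescent_step`): the terms `[(c + jM)/(Mq)]⁺` run over all residues `e mod Mq` prime to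
`M`, which split into `q ∤ e` (giving `T_{Mq}`) and `e = q e'` (giving `χ'(q) T_M`), while
`∑_c χ'(c) [qc/M]⁺ = χ'(q)⁻¹ T_M` by the substitution `c ↦ qc` (the symbol only depends on
`r mod ℤ`, `ratPlusSymbol_add_intCast_holds`). Inducting over the prime factors of `n/d`
(`heckeDescent_induct`), `T_n ≠ 0 ⟹ T_d ≠ 0`; finally `T_n` is the hypothesis' sum over
`(ℤ/n)ˣ` of the induced character `changeLevel χ'`, and `T_d = ∑_{b mod d} χ'(b) [b/d]⁺`
since `χ'` vanishes off the units.
-/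

noncomputable section

set_option linter.dupNamespace false

namespace Summit.BirchSwinnertonDyer.BirchSwinnertonDyer.Theorems

open CongruenceSubgroup Literature.NumberTheory.EllipticCurves
  Literature.NumberTheory.EllipticCurves.ModularForms

open scoped MatrixGroups ModularForm

/-! ### Elementary reindexing lemmas -/

/-- Splitting a sum over `range (a * b)` along `r = x + a * y`, `x < a`, `y < b`. -/
theorem heckeDescent_sum_range_mul {A : Type*} [AddCommMonoid A] (a b : ℕ) (F : ℕ → A) :
    ∑ r ∈ Finset.range (a * b), F r =
      ∑ x ∈ Finset.range a, ∑ y ∈ Finset.range b, F (x + a * y) := by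
  induction b with
  | zero => simp
  | succ b ih =>
    rw [Nat.mul_succ, Finset.sum_range_add, ih, ← Finset.sum_add_distrib]
    refine Finset.sum_congr rfl fun x _ ↦ ?_
    rw [Finset.sum_range_succ, add_comm (a * b) x]

/-- A sum over the units of `ℤ/Kℤ`, written through the representatives `val ∈ [0, K)`, is the
sum over the integers `0 ≤ c < K` prime to `K`. -/
theorem heckeDescent_sum_units_eq {A : Type*} [AddCommMonoid A] (K : ℕ) [NeZero K]
    (G : ℕ → A) :
    ∑ a : (ZMod K)ˣ, G (a : ZMod K).val =
      ∑ c ∈ (Finset.range K).filter (fun c ↦ c.Coprime K), G c := by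
  refine Finset.sum_bij' (fun a _ ↦ (a : ZMod K).val)
    (fun c hc ↦ ZMod.unitOfCoprime c (Finset.mem_filter.mp hc).2) ?_ ?_ ?_ ?_ ?_
  · intro a _
    exact Finset.mem_filter.mpr
      ⟨Finset.mem_range.mpr (ZMod.val_lt _), ZMod.val_coe_unit_coprime a⟩
  · intro c _
    exact Finset.mem_univ _
  · intro a _
    ext
    rw [ZMod.coe_unitOfCoprime, ZMod.natCast_zmod_val]
  · intro c hc
    rw [ZMod.coe_unitOfCoprime, ZMod.val_natCast,
      Nat.mod_eq_of_lt (Finset.mem_range.mp (Finset.mem_filter.mp hc).1)]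
  · intro a _
    rfl

/-- A sum over `ℤ/Kℤ`, written through the representatives `val ∈ [0, K)`, is the sum over the
integers `0 ≤ c < K`. -/
theorem heckeDescent_sum_zmod_eq {A : Type*} [AddCommMonoid A] (K : ℕ) [NeZero K]
    (G : ℕ → A) :
    ∑ b : ZMod K, G b.val = ∑ c ∈ Finset.range K, G c := by
  refine Finset.sum_nbij' (fun b ↦ b.val) (fun c ↦ (c : ZMod K)) ?_ ?_ ?_ ?_ ?_
  · intro b _
    exact Finset.mem_range.mpr (ZMod.val_lt _)
  · intro c _
    exact Finset.mem_univ _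
  · intro b _
    exact ZMod.natCast_zmod_val b
  · intro c hc
    rw [ZMod.val_natCast, Nat.mod_eq_of_lt (Finset.mem_range.mp hc)]
  · intro b _
    rfl

/-- `∑_{b mod d} χ(b) Q(b) = ∑_{0 ≤ c < d, (c, d) = 1} χ(c) Q(c)` for a Dirichlet character
`χ mod d`: the character vanishes off the units. -/
theorem heckeDescent_sum_zmod_char {d : ℕ} [NeZero d] (χ : DirichletCharacter ℂ d)
    (Q : ℕ → ℂ) :
    ∑ b : ZMod d, χ b * Q b.val =
      ∑ c ∈ (Finset.range d).filter (fun c ↦ c.Coprime d), χ (c : ZMod d) * Q c := by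
  have h1 : ∑ b : ZMod d, χ b * Q b.val = ∑ c ∈ Finset.range d, χ (c : ZMod d) * Q c := by
    have h := heckeDescent_sum_zmod_eq d (fun c ↦ χ (c : ZMod d) * Q c)
    simp only [ZMod.natCast_zmod_val] at h
    exact h
  rw [h1, Finset.sum_filter]
  refine Finset.sum_congr rfl fun c _ ↦ ?_
  split_ifs with hc
  · rfl
  · rw [MulChar.map_nonunit χ (by rwa [ZMod.isUnit_iff_coprime]), zero_mul]

/-! ### The Hecke relation for the rational plus symbols, in `ℂ` -/

/-- **Hecke relation for `[·]⁺` with the complex coefficient `a_p(f)`**: for a normalised newform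
`f ∈ S₂(Γ₀(N))` with rational coefficients and a prime `p ∤ N`,
`a_p(f) [r]⁺ = ∑_{j mod p} [(r + j)/p]⁺ + [p r]⁺` in `ℂ` (Mazur–Tate–Teitelbaum 1986, §I.4 (4.2)):
the real part of `cuspCoeff_mul_plusSymbol` (`a_p(f)` is real,
`cuspCoeff_im_eq_zero_of_coeffField_eq_bot`), divided by `Ω⁺_f` and made rational by
`ratCast_ratPlusSymbol_holds` (`([r]⁺ : ℝ) = re plusSymbol(r) / Ω⁺_f`). -/
theorem heckeDescent_cuspCoeff_mul_ratPlusSymbol {N : ℕ} [NeZero N] {f : CuspForm (Gamma0 N) 2}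
    (hf : IsNewform0 f) (hQ : coeffField f = ⊥) {p : ℕ} (hp : p.Prime) (hpN : ¬ p ∣ N) (r : ℚ) :
    cuspCoeff f p * ((ratPlusSymbol f r : ℚ) : ℂ) =
      ∑ j : Fin p, ((ratPlusSymbol f ((r + j) / p) : ℚ) : ℂ) +
        ((ratPlusSymbol f (p * r) : ℚ) : ℂ) := by
  haveI : NeZero p := ⟨hp.ne_zero⟩
  have hreal : ∀ n, (cuspCoeff f n).im = 0 := cuspCoeff_im_eq_zero_of_coeffField_eq_bot hQ
  have hrat : ∀ r : ℚ, (ratPlusSymbol f r : ℝ) = normalizedPlusSymbol f r :=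
    fun r ↦ ratCast_ratPlusSymbol_holds hf hQ r
  have h := cuspCoeff_mul_plusSymbol p hf hp hpN r
  have hre := congr_arg Complex.re h
  rw [Complex.mul_re, hreal p, zero_mul, sub_zero, Complex.add_re, Complex.re_sum] at hre
  have key : (cuspCoeff f p).re * (ratPlusSymbol f r : ℝ) =
      ∑ j : Fin p, (ratPlusSymbol f ((r + j) / p) : ℝ) + (ratPlusSymbol f (p * r) : ℝ) := by
    simp only [hrat, normalizedPlusSymbol]
    rw [mul_div_assoc', hre, add_div, Finset.sum_div]
  have hap : cuspCoeff f p = ((cuspCoeff f p).re : ℂ) :=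
    Complex.ext (by simp) (by simp [hreal p])
  rw [hap]
  exact_mod_cast key

/-! ### The one-prime descent step and the induction -/

/-- **One-prime Hecke descent step** (Fearnley–Kisilevsky–Kuwata 2012, proof of Thm. 3.5;
Mazur–Tate–Teitelbaum 1986, §I.4). Let `P : ℚ → ℂ` be `1`-periodic and satisfy the Hecke relation
`a_p P(r) = ∑_{j mod p} P((r + j)/p) + P(p r)` at a prime `p`, let `χ` be a Dirichlet character
mod `d`, and let `d ∣ M` with `p ∤ M`. Then, with `T_K = ∑_{0 ≤ c < K, (c, K) = 1} χ(c) P(c/K)`,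
`T_{Mp} = (a_p − χ(p) − χ(p)⁻¹) T_M`. -/
theorem heckeDescent_step (P : ℚ → ℂ) (hper : ∀ (r : ℚ) (z : ℤ), P (r + z) = P r)
    {p : ℕ} (hp : p.Prime) {ap : ℂ}
    (hheck : ∀ r : ℚ, ap * P r = ∑ j : Fin p, P ((r + j) / p) + P (p * r))
    {d : ℕ} (χ : DirichletCharacter ℂ d) {M : ℕ} (hM : M ≠ 0) (hdM : d ∣ M) (hpM : ¬ p ∣ M) :
    ∑ e ∈ (Finset.range (M * p)).filter (fun e ↦ e.Coprime (M * p)),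
        χ (e : ZMod d) * P ((e : ℚ) / ((M * p : ℕ) : ℚ)) =
      (ap - χ (p : ZMod d) - (χ (p : ZMod d))⁻¹) *
        ∑ c ∈ (Finset.range M).filter (fun c ↦ c.Coprime M), χ (c : ZMod d) * P ((c : ℚ) / M) := by
  have hp0 : 0 < p := hp.pos
  have hpM' : p.Coprime M := (Nat.Prime.coprime_iff_not_dvd hp).mpr hpM
  have hMq : (M : ℚ) ≠ 0 := by exact_mod_cast hM
  have hpq : (p : ℚ) ≠ 0 := by exact_mod_cast hp.ne_zero
  have hMd : (M : ZMod d) = 0 := (ZMod.natCast_eq_zero_iff M d).mpr hdM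
  have hχp : χ (p : ZMod d) ≠ 0 :=
    (((ZMod.isUnit_iff_coprime p d).mpr (hpM'.coprime_dvd_right hdM)).map χ).ne_zero
  have hcastmod : ∀ a : ℕ, ((a % M : ℕ) : ZMod d) = (a : ZMod d) := fun a ↦ by
    rw [ZMod.natCast_eq_natCast_iff', Nat.mod_mod_of_dvd a hdM]
  -- periodicity: `P(a/M)` only depends on `a mod M`
  have hperN : ∀ a : ℕ, P ((a : ℚ) / M) = P (((a % M : ℕ) : ℚ) / M) := by
    intro a
    have hq : (a : ℚ) = ((a % M : ℕ) : ℚ) + (M : ℚ) * ((a / M : ℕ) : ℚ) := by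
      exact_mod_cast (Nat.mod_add_div a M).symm
    calc P ((a : ℚ) / M) = P (((a % M : ℕ) : ℚ) / M + ((a / M : ℕ) : ℤ)) := by
          rw [hq, Int.cast_natCast, add_div, mul_div_cancel_left₀ _ hMq]
      _ = P (((a % M : ℕ) : ℚ) / M) := hper _ _
  -- Step 1: the Hecke relation summed against `χ` over the units mod `M`
  have h1 : ap * ∑ c ∈ (Finset.range M).filter (fun c ↦ c.Coprime M), χ (c : ZMod d) * P ((c : ℚ) / M) =
      ∑ c ∈ (Finset.range M).filter (fun c ↦ c.Coprime M), ∑ j ∈ Finset.range p,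
          χ (c : ZMod d) * P (((c + M * j : ℕ) : ℚ) / ((M * p : ℕ) : ℚ)) +
        ∑ c ∈ (Finset.range M).filter (fun c ↦ c.Coprime M),
          χ (c : ZMod d) * P (((p * c : ℕ) : ℚ) / M) := by
    rw [Finset.mul_sum, ← Finset.sum_add_distrib]
    refine Finset.sum_congr rfl fun c _ ↦ ?_
    rw [mul_left_comm, hheck, mul_add, Finset.mul_sum,
      Fin.sum_univ_eq_sum_range (fun j ↦ χ (c : ZMod d) * P (((c : ℚ) / M + j) / p)) p]
    congr 1
    · refine Finset.sum_congr rfl fun j _ ↦ ?_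
      congr 2
      push_cast
      field_simp
    · congr 2
      push_cast
      ring
  -- Step 2: the double sum is the sum over the residues mod `M p` prime to `M`
  have h2 : ∑ c ∈ (Finset.range M).filter (fun c ↦ c.Coprime M), ∑ j ∈ Finset.range p,
        χ (c : ZMod d) * P (((c + M * j : ℕ) : ℚ) / ((M * p : ℕ) : ℚ)) =
      ∑ e ∈ (Finset.range (M * p)).filter (fun e ↦ e.Coprime M),
        χ (e : ZMod d) * P ((e : ℚ) / ((M * p : ℕ) : ℚ)) := by
    simp only [Finset.sum_filter]
    rw [heckeDescent_sum_range_mul M p]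
    refine Finset.sum_congr rfl fun c _ ↦ ?_
    split_ifs with hc
    · refine Finset.sum_congr rfl fun j _ ↦ ?_
      rw [if_pos ((Nat.coprime_add_mul_left_left c M j).mpr hc)]
      congr 2
      push_cast
      rw [hMd, zero_mul, add_zero]
    · symm
      refine Finset.sum_eq_zero fun j _ ↦ ?_
      rw [if_neg (fun h ↦ hc ((Nat.coprime_add_mul_left_left c M j).mp h))]
  -- Step 3: split the residues mod `M p` prime to `M` according to `p ∣ e`
  have h3 : ∑ e ∈ (Finset.range (M * p)).filter (fun e ↦ e.Coprime M),
        χ (e : ZMod d) * P ((e : ℚ) / ((M * p : ℕ) : ℚ)) =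
      ∑ e ∈ (Finset.range (M * p)).filter (fun e ↦ e.Coprime (M * p)),
          χ (e : ZMod d) * P ((e : ℚ) / ((M * p : ℕ) : ℚ)) +
        χ (p : ZMod d) *
          ∑ c ∈ (Finset.range M).filter (fun c ↦ c.Coprime M), χ (c : ZMod d) * P ((c : ℚ) / M) := by
    rw [← Finset.sum_filter_add_sum_filter_not
      ((Finset.range (M * p)).filter (fun e ↦ e.Coprime M)) (fun e ↦ ¬ p ∣ e)]
    congr 1
    · refine Finset.sum_congr ?_ fun _ _ ↦ rfl
      rw [Finset.filter_filter]
      refine Finset.filter_congr fun e _ ↦ ?_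
      rw [Nat.coprime_mul_iff_right, Nat.coprime_comm (n := e) (m := p), hp.coprime_iff_not_dvd]
    · rw [Finset.mul_sum]
      symm
      refine Finset.sum_nbij' (fun c ↦ p * c) (fun e ↦ e / p) ?_ ?_ ?_ ?_ ?_
      · intro c hc
        obtain ⟨hcM, hcop⟩ := Finset.mem_filter.mp hc
        refine Finset.mem_filter.mpr ⟨Finset.mem_filter.mpr ⟨?_, ?_⟩, ?_⟩
        · rw [Finset.mem_range] at hcM ⊢
          rw [mul_comm M p]
          exact Nat.mul_lt_mul_of_pos_left hcM hp0
        · exact Nat.Coprime.mul_left hpM' hcop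
        · exact not_not.mpr (dvd_mul_right p c)
      · intro e he
        obtain ⟨he', hpe⟩ := Finset.mem_filter.mp he
        obtain ⟨heR, hecop⟩ := Finset.mem_filter.mp he'
        refine Finset.mem_filter.mpr ⟨?_, ?_⟩
        · rw [Finset.mem_range] at heR ⊢
          exact (Nat.div_lt_iff_lt_mul hp0).mpr heR
        · exact hecop.coprime_dvd_left (Nat.div_dvd_of_dvd (not_not.mp hpe))
      · intro c _
        exact Nat.mul_div_cancel_left c hp0
      · intro e he
        exact Nat.mul_div_cancel' (not_not.mp (Finset.mem_filter.mp he).2)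
      · intro c _
        rw [Nat.cast_mul, map_mul, mul_assoc]
        congr 2
        push_cast
        rw [mul_comm (M : ℚ) p, mul_div_mul_left _ _ hpq]
  -- Step 4: the substitution `c ↦ p c mod M` in `T_M`
  have h4 : χ (p : ZMod d) *
        ∑ c ∈ (Finset.range M).filter (fun c ↦ c.Coprime M),
          χ (c : ZMod d) * P (((p * c : ℕ) : ℚ) / M) =
      ∑ c ∈ (Finset.range M).filter (fun c ↦ c.Coprime M), χ (c : ZMod d) * P ((c : ℚ) / M) := by
    rw [Finset.mul_sum]
    have hmem : ∀ c ∈ (Finset.range M).filter (fun c ↦ c.Coprime M),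
        p * c % M ∈ (Finset.range M).filter (fun c ↦ c.Coprime M) := by
      intro c hc
      obtain ⟨-, hcop⟩ := Finset.mem_filter.mp hc
      refine Finset.mem_filter.mpr ⟨Finset.mem_range.mpr (Nat.mod_lt _ (Nat.pos_of_ne_zero hM)), ?_⟩
      have h : Nat.Coprime M (p * c) := Nat.Coprime.mul_right hpM'.symm hcop.symm
      rw [Nat.coprime_iff_gcd_eq_one, Nat.gcd_rec] at h
      exact Nat.coprime_iff_gcd_eq_one.mp h
    have hinj : Set.InjOn (fun c ↦ p * c % M) ((Finset.range M).filter (fun c ↦ c.Coprime M)) := by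
      intro c hc c' hc' h
      have hcM := Finset.mem_range.mp (Finset.mem_filter.mp hc).1
      have hc'M := Finset.mem_range.mp (Finset.mem_filter.mp hc').1
      exact Nat.ModEq.eq_of_lt_of_lt (Nat.ModEq.cancel_left_of_coprime hpM'.symm h) hcM hc'M
    have hsurj : Set.SurjOn (fun c ↦ p * c % M) ((Finset.range M).filter (fun c ↦ c.Coprime M))
        ((Finset.range M).filter (fun c ↦ c.Coprime M)) := by
      intro b hb
      obtain ⟨a, ha, rfl⟩ := Finset.surj_on_of_inj_on_of_card_le (fun c _ ↦ p * c % M)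
        (fun c hc ↦ hmem c hc) (fun c c' hc hc' h ↦ hinj hc hc' h) le_rfl b hb
      exact ⟨a, ha, rfl⟩
    refine Finset.sum_nbij (fun c ↦ p * c % M) hmem hinj hsurj fun c _ ↦ ?_
    rw [← mul_assoc, ← map_mul, ← Nat.cast_mul, hperN (p * c), hcastmod]
  -- Step 5: assemble
  have hD : ∑ c ∈ (Finset.range M).filter (fun c ↦ c.Coprime M),
        χ (c : ZMod d) * P (((p * c : ℕ) : ℚ) / M) =
      (χ (p : ZMod d))⁻¹ *
        ∑ c ∈ (Finset.range M).filter (fun c ↦ c.Coprime M), χ (c : ZMod d) * P ((c : ℚ) / M) := by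
    rw [← h4, ← mul_assoc, inv_mul_cancel₀ hχp, one_mul]
  linear_combination (-1 : ℂ) * (h1 + h2 + h3 + hD)

/-- **Hecke descent along the prime factors** of `m`: with `T_K = ∑_{0 ≤ c < K, (c,K)=1} χ(c) P(c/K)`
as in `heckeDescent_step`, if `M m` is square-free and prime to `N` (so that every prime `q ∣ m`
satisfies `q ∤ M N` and the step applies), then `T_{M m} ≠ 0 ⟹ T_M ≠ 0`
(induction on the prime factorisation of `m`). -/
theorem heckeDescent_induct (P : ℚ → ℂ) (hper : ∀ (r : ℚ) (z : ℤ), P (r + z) = P r)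
    {N : ℕ} (a : ℕ → ℂ)
    (hheck : ∀ p : ℕ, p.Prime → ¬ p ∣ N → ∀ r : ℚ,
      a p * P r = ∑ j : Fin p, P ((r + j) / p) + P (p * r))
    {d : ℕ} (χ : DirichletCharacter ℂ d) :
    ∀ (m M : ℕ), M ≠ 0 → d ∣ M → Squarefree (M * m) → (M * m).Coprime N →
      ∑ e ∈ (Finset.range (M * m)).filter (fun e ↦ e.Coprime (M * m)),
          χ (e : ZMod d) * P ((e : ℚ) / ((M * m : ℕ) : ℚ)) ≠ 0 →
      ∑ c ∈ (Finset.range M).filter (fun c ↦ c.Coprime M), χ (c : ZMod d) * P ((c : ℚ) / M) ≠ 0 := by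
  intro m
  induction m using induction_on_primes with
  | zero =>
    intro M _ _ hsq
    rw [mul_zero] at hsq
    exact absurd hsq not_squarefree_zero
  | one =>
    intro M _ _ _ _ h
    simpa only [mul_one] using h
  | prime_mul p m hp ih =>
    intro M hM hdM hsq hcop h
    rw [← mul_assoc] at hsq hcop h
    have hMp : M * p ≠ 0 := left_ne_zero_of_mul hsq.ne_zero
    have h' := ih (M * p) hMp (hdM.mul_right p) hsq hcop h
    have hsq' : Squarefree (M * p) := hsq.squarefree_of_dvd (dvd_mul_right _ m)
    have hcop' : (M * p).Coprime N := hcop.coprime_dvd_left (dvd_mul_right _ m)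
    have hpM : ¬ p ∣ M := by
      rintro ⟨k, rfl⟩
      exact hp.ne_one (Nat.isUnit_iff.mp (hsq' p ⟨k, by ring⟩))
    have hpN : ¬ p ∣ N :=
      (Nat.Prime.coprime_iff_not_dvd hp).mp (hcop'.coprime_dvd_left (dvd_mul_left p M))
    rw [heckeDescent_step P hper hp (hheck p hp hpN) χ hM hdM hpM] at h'
    exact right_ne_zero_of_mul h'

/-! ### The stub -/

/-- **Hecke descent of twisted plus-symbol sums** (registered stub `stub_heckeDescent` of line
`Sketch`; Fearnley–Kisilevsky–Kuwata 2012, proof of Thm. 3.5; Mazur–Tate–Teitelbaum 1986, §I.4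
(4.2)): for a rational newform `f ∈ S₂(Γ₀(N))`, a square-free `n` prime to `N`, `d ∣ n` and a
character `χ' mod d`, `∑_{a ∈ (ℤ/n)ˣ} χ'(a)[a/n]⁺ = ∏_{q ∣ n/d} (a_q − χ'(q) − χ'(q)⁻¹) ·
∑_{b mod d} χ'(b)[b/d]⁺`, hence non-vanishing at level `n` descends to level `d`
(`heckeDescent_induct` for `P = [·]⁺_f`, which is `1`-periodic by `ratPlusSymbol_add_intCast_holds`
and Hecke by `heckeDescent_cuspCoeff_mul_ratPlusSymbol`). -/
theorem stub_heckeDescent :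
    ∀ (N : ℕ) [NeZero N] (f : CuspForm (Gamma0 N) 2), IsNewform0 f → coeffField f = ⊥ →
      ∀ (n d : ℕ) [NeZero n] [NeZero d] (hdn : d ∣ n), Squarefree n → n.Coprime N →
      ∀ χ' : DirichletCharacter ℂ d,
        (∑ a : (ZMod n)ˣ, (DirichletCharacter.changeLevel hdn χ') (a : ZMod n) *
            ((ratPlusSymbol f (((a : ZMod n).val : ℚ) / n) : ℚ) : ℂ)) ≠ 0 →
        (∑ b : ZMod d, χ' b * ((ratPlusSymbol f ((b.val : ℚ) / d) : ℚ) : ℂ)) ≠ 0 := by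
  intro N _ f hf hQ n d _ _ hdn hsq hcop χ' hsum
  -- the `1`-periodic function `P = [·]⁺_f` (cast to `ℂ`) and its Hecke relations
  obtain ⟨P, hP⟩ : ∃ P : ℚ → ℂ, ∀ r, ((ratPlusSymbol f r : ℚ) : ℂ) = P r := ⟨_, fun r ↦ rfl⟩
  have hper : ∀ (r : ℚ) (z : ℤ), P (r + z) = P r := fun r z ↦ by
    rw [← hP, ← hP, ratPlusSymbol_add_intCast_holds (f := f) r z]
  have hheck : ∀ p : ℕ, p.Prime → ¬ p ∣ N → ∀ r : ℚ,
      cuspCoeff f p * P r = ∑ j : Fin p, P ((r + j) / p) + P (p * r) := by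
    intro p hp hpN r
    simp only [← hP]
    exact heckeDescent_cuspCoeff_mul_ratPlusSymbol hf hQ hp hpN r
  simp only [hP] at hsum ⊢
  -- Step 1: the hypothesis is `T_n ≠ 0`
  have hTn : ∑ c ∈ (Finset.range n).filter (fun c ↦ c.Coprime n),
      χ' (c : ZMod d) * P ((c : ℚ) / n) ≠ 0 := by
    rw [← heckeDescent_sum_units_eq n (fun c ↦ χ' (c : ZMod d) * P ((c : ℚ) / n))]
    convert hsum using 2 with a
    rw [DirichletCharacter.changeLevel_eq_cast_of_dvd χ' hdn a, ZMod.cast_eq_val]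
  -- Step 2: descend along `n = d * (n / d)`
  have hTd : ∑ c ∈ (Finset.range d).filter (fun c ↦ c.Coprime d),
      χ' (c : ZMod d) * P ((c : ℚ) / d) ≠ 0 := by
    refine heckeDescent_induct P hper (fun p ↦ cuspCoeff f p) hheck χ' (n / d) d (NeZero.ne d)
      dvd_rfl ?_ ?_ ?_
    · rwa [Nat.mul_div_cancel' hdn]
    · rwa [Nat.mul_div_cancel' hdn]
    · rwa [Nat.mul_div_cancel' hdn]
  -- Step 3: back to the sum over `ℤ/dℤ`
  rwa [heckeDescent_sum_zmod_char χ' (fun c ↦ P ((c : ℚ) / d))]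

end Summit.BirchSwinnertonDyer.BirchSwinnertonDyer.Theorems

end
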